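import Summits.HodgeConjecture.HodgeConjecture.Cruxes.H413.Lines.R90_S2_ArchPacketXiA      -- S2 file A ΞA (BUILT): `R90.S2.ArchMemberIota` :126, Σ∞-ι `ArchPacketIotaLetter` :160, ★-grade `archPacketIotaLetter_of_ofRecord` :242, head `s2Qpsi_of_sigmas` :203; carries ★ `K2E1bCarriersOfRecord` (`jInfOfRecord`, `dsInfOfRecord`), ★ `F0P3XiArchPacketOfRecord`, ★ K1 `F0P3cPinCompactChi` (`S2PinCompactLetter`), the LH1 leaf (`S2QpsiLetter`)
import Summits.HodgeConjecture.HodgeConjecture.Theorems.R90S2ArchPacketPinOfRecord        -- ★ PIN #18 `R90.S2.archPacketAt_πn_eq_jInfOfRecord` :139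
import Summits.HodgeConjecture.HodgeConjecture.Theorems.F0P3XiArchDataOfRecord           -- ★ `archTypeOfRecord`
import Summits.HodgeConjecture.HodgeConjecture.Theorems.F0P3AntiholCohUnitaryToken       -- ★ `exists_cohUnitaryToken_of_isCot_cpt` :243; carries ★ `F0P3UnitaryLocOfRecord` (`clInfChoiceU` :128, `clInfChoiceU_eq_ofModule` :183), ★ `F0P3ArchIsotypyConj` (`archIsotypy_cm_of_hol_half` :277), ★ `F0P3StubF1aHolHalf` (`archIsotypy_of_isHolCotangentAt` :62)
import Summits.HodgeConjecture.HodgeConjecture.Theorems.R90S7ArchClassOfRecordOfRepresentative  -- ★ (m1) brick (S7-R22 (1), R90-C146-p01 (g2)): `isKcSpherical_of_isCot`, `clInfChoiceU_repOf_classOf_eq_of_isCot`, `tupleOf_fst_classOfSph_eq` (+ membership transport); carries ★ S9 `R90S9SphericalClassTuple` (`tupleOf`, `classOfSph`, `IsKcSpherical`)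
import HarnessLib

/-!
# R90-TF · S7 «§14.6» — FILE E «(S-G)∞ JUNCTION», EDITION 2 «TUPLE TWIN» (SORRY-FREE, HYPOTHESIS FORM; ED. 1 + the S9-tuple-currency twin of «(S-G)∞» and its ★ equivalence): the S9 organ «(S-G)∞» BY TYPE ⟹ `ArchMemberIota` over the carriers of record
# ⟹ Σ∞-ι ⟹ the organ Ξ∞ (modulo Σ∞-cpt) — junction JQ-S7-7c of RULINGS S7-R20 ∕ S7-R21 ([Rogawski1990, §14.6 Thm. 14.6.4 and its proof p. 244; §13.3 Thm. 13.3.6 (c) p. 202;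
# §12.3 Prop. 12.3.3 p. 178; §14.5 p. 237]; [FlathCorvallis1979, Thm. 3]; [BorelWallach2000, VI Thm. 4.11])

Cell `hodgecm-mathlib`, crux H413 (`stmt-HodgeConjecture-24833`), route of record `HCCMUnconditional`; programme R90-TF (brief `director/R90-BRIEF.v2.md` 1f40d54518340a35),
section S7 = Rogawski §14.6 (base `R90-C146`); dealer∕pen LH7-plan (g5) RULINGS S7-R20 (2026-09-05T01:36:43Z: junction JQ-S7-7c «(S-G)∞ → Σ∞-ι → D2», target
`archMemberIota_ofRecord`), S7-R21 (02:29:03Z: JQ-S7-7c := ONE organ «(S-G)∞», owner S9) and S7-R21 (3′) + DEAL D-S7#12 (02:36:20Z: «the junction goes into the tree now, sorry-free,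
in hypothesis form»); typed by the prover seat R90-C146-p01 (g2) from its boxed scratch probe `R90/R90-C146-p01/g2/jq77c/JQS77c_ResidueProbe.v1.lean` ec4ae83b44219a78 (LH7-audit1 (g2)
BOX PASS 02:32:46Z) and memo `…/CENSUS-D-S7-11-JQS77cResidue.v1.C146p01-g2.md` 1a2366b9f77cd1f1; written by the S7 pen (`ledger crux write stmt-HodgeConjecture-24833
Lines/R90_S7_ArchMemberIotaJunctionE.lean`) after a box.

EDITION 2 «TUPLE TWIN» (RULING S7-R22 (2)(4), 2026-09-05T03:00:19Z, on R90-C146-p01 (g2)'s probe D-S7#13 `R90/R90-C146-p01/g2/jq77c/SGInf_BridgeProbe.v1.lean` 7799285e05d9203c +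
memo `…/CENSUS-D-S7-13-SGInfBridge.v1.C146p01-g2.md` a0a2089260aefda8): EVERY EDITION-1 DECLARATION BYTE-FROZEN; ADDED (i) the import of the ★ (m1) brick
`R90S7ArchClassOfRecordOfRepresentative` (letter-free: the archimedean class of record is an invariant of the GK-class of a cotangent `P`), (ii) §1b `SGInfTupleLetter` = «(S-G)∞» in S9's TUPLE
CURRENCY (probe :95–:111 verbatim: same frame, conclusion `(tupleOf … (classOfSph … P hsph)).1 ∈ (archPacketOfRecord ι μω jInfOfRecord dsInfOfRecord ξ).members`) — the binder the
residue of JQ-S7-7c is NAMED to (S7-R22 (2): = ★ `archSlot_of_contribA_guarded` read at the `X_cm` datum; OWNER S9, whose export may target E1 or this twin), (iii) §5 the ★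
equivalence `sgInf_iff_tuple : SGInfLetter ↔ SGInfTupleLetter` and the one-line doors `archMemberIota_of_sgInfTuple` ∕ `archPacketIota_of_sgInfTuple` ∕ `s2Qpsi_of_sgInfTuple`.  Still ZERO
`sorry`, ZERO socket.  IMPORT LAW amended by S7-R22 (4) by EXACTLY ONE module: the ★ brick (★-only; it carries ★ S9 `Theorems` `R90S9SphericalClassTuple` ∕ `…InnerFormSec146Scope` for
`tupleOf` ∕ `classOfSph` ∕ `IsKcSpherical`; still NEVER an S9 `Lines` module, FILE D, S7 A∕B∕C, the PK leaf, T-A∕T-B∕AGG∕KitRung0∕Index); typed by LH7-typ1 (g4) (cand at HOME, written only by the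
S7 pen after boxes).

WHAT THIS FILE IS.  S2's archimedean socket at the non-compact place, Σ∞-ι `R90.S2.stub_R90_S2_archPacketIota : ArchPacketIotaLetter` (XiA :169), and S7's re-typing of its consumed
content, D2 `R90.S7.stub_R90_S7_xiIotaLocus : XiIotaLocusLetter` (FILE D), are both PAID the day the S9 section proves print's archimedean clause of Thm. 13.3.6 (c) ∕ 14.6.4 at the
real place under `ι`.  §1 types that clause as the letter «(S-G)∞» `SGInfLetter` in the currency S9 actually produces — the ARCHIMEDEAN CLASS OF RECORD `clInfChoiceU [J⁺] P` (★
`F0P3UnitaryLocOfRecord`; = S9's `(tupleOf π′).1` on the representative of record, ★ `R90S9SphericalClassTuple.tupleOf_fst`) lies in the ARCHIMEDEAN PACKET OF RECORD `archPacketOfRecord ι μω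
jInfOfRecord dsInfOfRecord ξ` (★ `F0P3XiArchPacketOfRecord`; its two members are S9's B-pinned slots `a₀ ∕ a₂` of ★ `R90S9ArchSlotOfContribA2.archSlot_of_contribA_guarded`) — TOKEN-free,
SIGN-free, LOCUS-free.  §2 proves (★) that over the CARRIERS OF RECORD the `πⁿ` member is `jInfOfRecord` on and off the cohomological locus (PIN #18 + ★ `archPacketOfRecord_πn_of_not`), so
membership IS `ArchMemberIota`'s disjunction; §3 proves (★) that EVERY `(𝔤,K)`-token of a cotangent `P` has the archimedean class of record (F1a ★ + coh-unitary token ★ + ★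
`clInfChoiceU_eq_ofModule`); §4 assembles the S7-R20 target `ArchMemberIota jInfOfRecord dsInfOfRecord` from «(S-G)∞» taken AS A HYPOTHESIS BY TYPE (exactly as FILE D's D3 takes Σ∞-ι),
then Σ∞-ι (★-grade door XiA :242) and the organ Ξ∞ `S2QpsiLetter` modulo Σ∞-cpt (XiA head `s2Qpsi_of_sigmas` :203).  ZERO `sorry`, ZERO socket, NO head applying a socket: the
paid-modulo head `s2Qpsi_paid₂ := s2Qpsi_of_sgInf ‹S9's export› R90.S2.stub_R90_S2_archPacketCompact` is the R90 INDEX's line in a later edition, and the ι-LOCUS corollary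
`xiIotaLocus_of_sgInf (h : SGInfLetter) : R90.S7.XiIotaLocusLetter := R90.S7.xiIotaLocus_of_archPacketIota (archPacketIota_of_sgInf h)` is ONE line for whoever imports FILE D + this file
(Index ED. ≥ 6) — stated here, not typed (FILE D's olean is not on the farm at typing time; no phantom import).

HEADS (for the Index pen ∕ S9 ∕ S2, S7-R21 (3′)): S9's export must INHABIT `R90.S7.SGInfLetter` (its body verbatim, any name — proposed `R90.S9.archClassOfRecord_mem_packetOfRecord_of_memXiFamily`)
or ship a bridge to it; the four bridges from S9's X-generic ★ `archSlot_of_contribA_guarded` at the datum are (m1) representative `repOf (classOf P)` ↦ `P` (★ `tupleOf_fst`,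
`areUnitarilyEquivalent_repOf`, `hasToken_of_areUnitarilyEquivalent`, `areGKEquivalent_of_tokens`; F1a + coh-unitary token ★ on the cotangent locus, no «ARCH» letter), (m2) `X.oneDimOf ξ h₁` ↦
`ξ : OneDimAutRepH L`, (m3) trigger `Γ.evpRep ∧ m′ ≠ 0` ↦ D6 `MemXiFamily` (S9 (B0) ∕ S5 «EvpMatch» currency), (m4) carriers `(jInf, dsInf) := (jInfOfRecord, dsInfOfRecord)` at `X_cm` (S2's word).

IMPORT LAW (S7-R21 (3′)): XiA (to NAME `ArchMemberIota`, `ArchPacketIotaLetter`, `archPacketIotaLetter_of_ofRecord`, `s2Qpsi_of_sigmas`, `S2PinCompactLetter`, `S2QpsiLetter`; it carries ★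
`K2E1bCarriersOfRecord`, ★ `F0P3XiArchPacketOfRecord`, ★ K1, the LH1 leaf) + ★ `R90S2ArchPacketPinOfRecord` + ★ `F0P3XiArchDataOfRecord` + ★ `F0P3AntiholCohUnitaryToken` + `HarnessLib`
ONLY; NEVER FILE D, never an S9 module, never S7 A∕B∕C, never the PK leaf ∕ T-A ∕ T-B ∕ AGG ∕ KitRung0 ∕ Index.  No instance declared (one LOCAL instance ATTRIBUTE, the Mathlib idiom XiA
:89 uses to mention `→ₗ⁅ℝ⁆ Module.End ℂ M`), no notation, no `Classical.choose`, one closed `Prop` def (§1), NO `sorry`.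

CIRCULARITY GUARD (S7-R19 §(4) ∕ S7-R20 ∕ S7-R21, binding): nothing here uses the organ Ξ∞ (`S2QpsiLetter` is only a CONCLUSION), FILE D, XiA's `s2Qpsi_paid`, the LH1 leaf's Ξ∞-derived
`casimirIota_holds` ∕ `pinCompact_holds` ∕ `casimirTau_holds`, or either archimedean socket; `--axioms` of every theorem below = {propext, Classical.choice, Quot.sound}.  The payer of
«(S-G)∞» (S9: the §14.6 identities at `X_cm`, ★ M1 slot bridge, ★ T1a linear independence) must keep the same guard.

## Honest label
E PAYS NOTHING by itself: it converts D2 ∕ Σ∞-ι into «S9's organ BY TYPE» with kernel-checked certificates; «(S-G)∞», Σ∞-ι and D2 stay OPEN, «(S-G)∞» S9-owned.  HC_CM is proved only modulo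
the 7 printed citations (2 remaining named inputs: hLiu418 = stmt-HodgeConjecture-24832, h413 = stmt-HodgeConjecture-24833) until rung 0 closes; count-neutral (0 sockets added; a Lines
edition: 0 proposals ∕ 0 registry acts by the typist).

## References
* [Rogawski1990] J. D. Rogawski, *Automorphic Representations of Unitary Groups in Three Variables*, Ann. of Math. Stud. 123 (1990): §14.6 Thm. 14.6.4 p. 243 and its proof
  pp. 244–245 (the factor `(Tr πⁿ(ξ_ι) ∓ Tr πˢ(ξ_ι))(f_ι)` at `ι ∉ S₀`); §13.3 Thm. 13.3.6 (c) p. 202; §12.3 Prop. 12.3.3 p. 178; §13.1 p. 199; §14.5 p. 237; Prop. 15.2.1 (b) p. 249.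
* [FlathCorvallis1979] D. Flath, *Decomposition of representations into tensor products*, Proc. Sympos. Pure Math. 33.1 (1979): Thm. 3 and Thm. 4.
* [BorelWallach2000] A. Borel, N. Wallach, *Continuous Cohomology, Discrete Subgroups, and Representations of Reductive Groups*, 2nd ed. (2000): VI Thm. 4.11; VII 2.10.
* [Marshall2014] S. Marshall, *Endoscopy and cohomology growth on U(3)*, Compos. Math. 150 (2014): §3.3 ¶3; §3.4 ¶1; §4.1.
-/

-- Mathlib idiom (as in XiA :89 and ★ `F0P3XiArchPacketOfRecord`): the commutator bracket on `Module.End ℂ M`, needed to MENTION `(uFormGroup (Fin 2) (Fin 1)).lie →ₗ⁅ℝ⁆ Module.End ℂ M`.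
attribute [local instance 100] LieRing.ofAssociativeRing

set_option autoImplicit false
-- the mandated namespace repeats the single-problem summit's segment (`HodgeConjecture.HodgeConjecture`)
set_option linter.dupNamespace false

noncomputable section

open NumberField IsDedekindDomain MeasureTheory
open scoped Matrix ComplexOrder

namespace Summit.HodgeConjecture.HodgeConjecture.R90.S7

open Literature.NumberTheory.Automorphic Literature.NumberTheory.Automorphic.UnitaryGroup
open Literature.NumberTheory.Automorphic.UnitaryGroup.CotangentForms
open Literature.NumberTheory.GaloisRepresentations
open Literature.NumberTheory.Rogawski1990
open Literature.RepresentationTheory.BorelWallach2000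
open Literature.RepresentationTheory.KonnoKonno2007 Literature.RepresentationTheory.KonnoKonno2007.RealDualPair
open Literature.RepresentationTheory.KonnoKonno2007.RealDualPair.UForm
open Summit.HodgeConjecture.HodgeConjecture.Cruxes.H413
open Summit.HodgeConjecture.HodgeConjecture.Cruxes.H413.F0P3XiArchDataOfRecord
open Summit.HodgeConjecture.HodgeConjecture.Cruxes.H413.F0P3XiArchPacketOfRecord (archPacketAt archPacketOfRecord archPacketOfRecord_def
  archPacketOfRecord_πn_of_not mem_archPacketOfRecord_iff)
open Summit.HodgeConjecture.HodgeConjecture.Cruxes.H413.K2E1bCarriersOfRecord (jInfOfRecord dsInfOfRecord)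
open Summit.HodgeConjecture.HodgeConjecture.Cruxes.H413.F0P3bArchDegOneClass (archDegOneClass)
open Summit.HodgeConjecture.HodgeConjecture.Cruxes.H413.F0P3InnerFormClassification (HasToken)
open Summit.HodgeConjecture.HodgeConjecture.Cruxes.H413.F0P3UnitaryLocOfRecord (clInfChoiceU clInfChoiceU_eq_ofModule)
open Summit.HodgeConjecture.HodgeConjecture.Cruxes.H413.F0P3AntiholCohUnitaryToken (exists_cohUnitaryToken_of_isCot_cpt)
open Summit.HodgeConjecture.HodgeConjecture.Cruxes.H413.F0P3ArchIsotypyConj (archIsotypy_cm_of_hol_half)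
open Summit.HodgeConjecture.HodgeConjecture.Cruxes.H413.F0P3cPinCompactChi (S2PinCompactLetter)
open Summit.HodgeConjecture.HodgeConjecture.Cruxes.H413.F0P3cS2SharpPaydown (S2QpsiLetter)
open Summit.HodgeConjecture.HodgeConjecture.R90.S2 (ArchMemberIota ArchPacketIotaLetter archPacketIotaLetter_of_ofRecord archPacketAt_πn_eq_jInfOfRecord s2Qpsi_of_sigmas)
open Summit.HodgeConjecture.HodgeConjecture.R90.S9.InnerFormSec146 (IsKcSpherical classOfSph tupleOf)

/-! ## §1 The letter «(S-G)∞» (a closed `Prop` over existing declarations; frame = `ArchMemberIota`'s without the token binders) -/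

/-- **«(S-G)∞» `SGInfLetter` — A COTANGENT MEMBER OF THE ξ-FAMILY HAS ITS ARCHIMEDEAN CLASS OF RECORD IN THE ARCHIMEDEAN PACKET OF RECORD OF `ξ`.**  The organ «(S-G)∞» of junction
JQ-S7-7c, OWNER S9 (RULING S7-R21 (1)(2)); this `def` is the TYPE S9's export must inhabit or bridge to (text of record = probe `JQS77c_ResidueProbe.v1.lean` ec4ae83b :123–:138 verbatim).
Frame of XiA's `ArchMemberIota` (CM `L` with `[L⁺:ℚ] ≥ 2`, `ι`, `H` with frame `T` at `ι` and positive definite at the complex places not over `ι`, automorphic measure `μ`, Rogawski's `μω`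
unitary with `μω ∘ BC = ω_{L∕L⁺}`, a discrete `P` of holomorphic or antiholomorphic cotangent type at the CM frame, a one-dimensional automorphic `ξ` with `MemXiFamily P … ξ`) WITHOUT the
token binders; CONCLUSION: the archimedean class of record ★ `clInfChoiceU L H ι T hT μ [J⁺] P` (the `(𝔤,K)`-class of a coh-unitary token of `P` at `ι` — print's `(P_ι)_K`,
[§14.5 p. 237]) lies in ★ `archPacketOfRecord ι μω jInfOfRecord dsInfOfRecord ξ` = `Π(ξ_ι ⊗ μ_ι) = {πⁿ, πˢ}(ξ.pη ι, ξ.qψ ι, t_ι)` over the CARRIERS OF RECORD (★ E1b #23).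
PRINT: Thm. 13.3.6 (c) ∕ Thm. 14.6.4 at the real place under `ι` — in the proof of Thm. 14.6.4 the right side of (14.6.3) carries at `ι ∉ S₀` the factor `(Tr πⁿ(ξ_ι) ∓ Tr πˢ(ξ_ι))(f_ι)`,
and comparison of coefficients [Prop. 13.8.1] puts `π′_ι` in `{πⁿ(ξ_ι), πˢ(ξ_ι)}` [Prop. 12.3.3].  TOKEN-free, SIGN-free, LOCUS-free; strictly UPSTREAM of Σ∞-ι and of FILE D's «ι-LOCUS».
WHY IT MIGHT FAIL AS TYPED: only as print fails at `ι`; `clInfChoiceU` sits in its genuine branch for a cotangent `P` (★ `exists_cohUnitaryToken_of_isCot_cpt`), so no junk value enters.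
[cite: Rogawski1990, §14.6 Thm. 14.6.4 p. 243 and proof p. 244; §13.3 Thm. 13.3.6 (c) p. 202; §12.3 Prop. 12.3.3 p. 178; §13.8 Prop. 13.8.1 pp. 212–213; §14.5 p. 237] [cite: FlathCorvallis1979, Thm. 3] -/
def SGInfLetter : Prop :=
  ∀ (L : Type) [Field L] [NumberField L] [IsCMField L] (ι : L →+* ℂ) (H : Matrix (Fin 3) (Fin 3) L) (T : GL (Fin 3) ℂ)
    (hT : (T : Matrix (Fin 3) (Fin 3) ℂ)ᴴ * H.map ι * (T : Matrix (Fin 3) (Fin 3) ℂ) = Literature.Geometry.ComplexHyperbolic.BallModel.J),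
    (∀ τ' : L →+* ℂ, InfinitePlace.mk τ' ≠ InfinitePlace.mk ι → (H.map τ').PosDef) →
    2 ≤ Module.finrank ℚ ↥(maximalRealSubfield L) →
    ∀ (μ : Measure (adelicGroupData (↥(maximalRealSubfield L)) L (IsCMField.complexConj L) 3 H).automorphicQuotient)
      [(adelicGroupData (↥(maximalRealSubfield L)) L (IsCMField.complexConj L) 3 H).IsAutomorphicMeasure μ]
      (μω : HeckeCharacter L) (hμu : μω.IsUnitary),
      (∀ x : Literature.NumberTheory.GaloisRepresentations.ideleGroup ↥(maximalRealSubfield L),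
        μω (AdeleRing.ideleBaseChange (↥(maximalRealSubfield L)) L x) = quadraticHeckeCharCM L x) →
    ∀ (P : DiscreteAutomorphicRep (adelicGroupData (↥(maximalRealSubfield L)) L (IsCMField.complexConj L) 3 H) μ),
      (P.IsHolCotangentAt (cmArchSection L ι H T hT) (cmCompactFactor L ι H T hT) ∨
        P.IsAntiholCotangentAt (cmArchSection L ι H T hT) (cmCompactFactor L ι H T hT)) →
      ∀ ξ : OneDimAutRepH L,
        MemXiFamily P (transpose_map_cmConjRingHom_eq_of_frame L ι H T hT) (isUnit_det_of_frame L ι H T hT) μω hμu ξ →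
          clInfChoiceU L H ι T hT μ (archDegOneClass 1 (Or.inl rfl)) P ∈ (archPacketOfRecord ι μω jInfOfRecord dsInfOfRecord ξ).members

/-! ## §1b «(S-G)∞_tup» — the SAME organ in S9's TUPLE CURRENCY (EDITION 2; probe D-S7#13 :95–:111 verbatim) -/

/-- **«(S-G)∞_tup» `SGInfTupleLetter` — THE SAME ORGAN IN S9's TUPLE CURRENCY** (RULING S7-R22 (2): the residue of JQ-S7-7c named to the binder).  Same frame as `SGInfLetter`;
for every witness `hsph` that `P` is `K_c`-spherical (a cotangent `P` always is — ★ brick `isKcSpherical_of_isCot`), the ARCHIMEDEAN COORDINATE OF S9's COMPONENTS RECORD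
`(tupleOf (classOfSph P hsph)).1` (★ `R90S9SphericalClassTuple.tupleOf_fst`: = `clInfChoiceU [J⁺] (repOf (classOf P))`, = `clInfChoiceU [J⁺] P` by the ★ brick
`tupleOf_fst_classOfSph_eq`) lies in the archimedean packet of record of `ξ`.  This is what S9's X-generic ★ `R90S9ArchSlotOfContribA2.archSlot_of_contribA_guarded` delivers at the
`X_cm` datum for `π′ := classOfSph P` once the reading bridges (m2)(m3)(m4) are in place (S9 ED. 5; memo a0a2089260aefda8 §2); ★-EQUIVALENT to `SGInfLetter` (§5 `sgInf_iff_tuple`).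
OWNER S9; S9's export may inhabit either letter.  TOKEN-free, SIGN-free, LOCUS-free.  WHY IT MIGHT FAIL AS TYPED: only as print fails at `ι` (as E1).
[cite: Rogawski1990, §14.6 Thm. 14.6.4 p. 243 and proof p. 244; §13.3 Thm. 13.3.6 (c) p. 202; §12.3 Prop. 12.3.3 p. 178; §13.8 Prop. 13.8.1 pp. 212–213] [cite: FlathCorvallis1979, Thm. 3] -/
def SGInfTupleLetter : Prop :=
  ∀ (L : Type) [Field L] [NumberField L] [IsCMField L] (ι : L →+* ℂ) (H : Matrix (Fin 3) (Fin 3) L) (T : GL (Fin 3) ℂ)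
    (hT : (T : Matrix (Fin 3) (Fin 3) ℂ)ᴴ * H.map ι * (T : Matrix (Fin 3) (Fin 3) ℂ) = Literature.Geometry.ComplexHyperbolic.BallModel.J),
    (∀ τ' : L →+* ℂ, InfinitePlace.mk τ' ≠ InfinitePlace.mk ι → (H.map τ').PosDef) →
    2 ≤ Module.finrank ℚ ↥(maximalRealSubfield L) →
    ∀ (μ : Measure (adelicGroupData (↥(maximalRealSubfield L)) L (IsCMField.complexConj L) 3 H).automorphicQuotient)
      [(adelicGroupData (↥(maximalRealSubfield L)) L (IsCMField.complexConj L) 3 H).IsAutomorphicMeasure μ]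
      (μω : HeckeCharacter L) (hμu : μω.IsUnitary),
      (∀ x : Literature.NumberTheory.GaloisRepresentations.ideleGroup ↥(maximalRealSubfield L),
        μω (AdeleRing.ideleBaseChange (↥(maximalRealSubfield L)) L x) = quadraticHeckeCharCM L x) →
    ∀ (P : DiscreteAutomorphicRep (adelicGroupData (↥(maximalRealSubfield L)) L (IsCMField.complexConj L) 3 H) μ),
      (P.IsHolCotangentAt (cmArchSection L ι H T hT) (cmCompactFactor L ι H T hT) ∨
        P.IsAntiholCotangentAt (cmArchSection L ι H T hT) (cmCompactFactor L ι H T hT)) →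
      ∀ ξ : OneDimAutRepH L,
        MemXiFamily P (transpose_map_cmConjRingHom_eq_of_frame L ι H T hT) (isUnit_det_of_frame L ι H T hT) μω hμu ξ →
          ∀ hsph : IsKcSpherical L ι H T hT μ P,
            (tupleOf L ι H T hT μ (classOfSph L ι H T hT μ P hsph)).1 ∈ (archPacketOfRecord ι μω jInfOfRecord dsInfOfRecord ξ).members

/-! ## §2 (★) Over the CARRIERS OF RECORD the `πⁿ` member is `jInfOfRecord`, on and off the locus — membership IS `ArchMemberIota`'s disjunction -/

/-- Over the carriers of record, `(archPacketOfRecord ι μω jInfOfRecord dsInfOfRecord ξ).πn = jInfOfRecord (pη ι) (qψ ι) t_ι` ALWAYS: on the cohomological locus by PIN #18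
(★ `R90.S2.archPacketAt_πn_eq_jInfOfRecord`: the kit's `[J^{rogSign}]` IS `jInfOfRecord` there), off it by ★ `archPacketOfRecord_πn_of_not` (definitional).
[cite: Rogawski1990, §12.3 Prop. 12.3.3 p. 178] -/
theorem archPacketOfRecord_πn_ofRecord {L : Type} [Field L] [NumberField L] [IsCMField L] (ι : L →+* ℂ) (μω : HeckeCharacter L) (ξ : OneDimAutRepH L) :
    (archPacketOfRecord ι μω jInfOfRecord dsInfOfRecord ξ).πn =
      jInfOfRecord (ξ.pη ι) (ξ.qψ ι) (ArchSignRecipe.tOfArchType (archTypeOfRecord μω) ι) := by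
  by_cases h : ξ.IsCohTrivialAt (ArchSignRecipe.tOfArchType (archTypeOfRecord μω) ι) ι
  · rw [archPacketOfRecord_def]
    unfold OneDimAutRepH.IsCohTrivialAt at h
    exact archPacketAt_πn_eq_jInfOfRecord h
  · exact archPacketOfRecord_πn_of_not jInfOfRecord dsInfOfRecord ι μω ξ h

/-- **Membership in the packet of record over the carriers of record IS `ArchMemberIota`'s disjunction** (`x = jInfOfRecord … ∨ x = dsInfOfRecord …`).
[cite: Rogawski1990, §12.3 Prop. 12.3.3 p. 178; §13.1 p. 199] -/
theorem mem_archPacketOfRecord_ofRecord_iff {L : Type} [Field L] [NumberField L] [IsCMField L] (ι : L →+* ℂ) (μω : HeckeCharacter L) (ξ : OneDimAutRepH L)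
    (x : GKIrrClass (uFormGroup (Fin 2) (Fin 1))) :
    x ∈ (archPacketOfRecord ι μω jInfOfRecord dsInfOfRecord ξ).members ↔
      x = jInfOfRecord (ξ.pη ι) (ξ.qψ ι) (ArchSignRecipe.tOfArchType (archTypeOfRecord μω) ι) ∨
        x = dsInfOfRecord (ξ.pη ι) (ξ.qψ ι) (ArchSignRecipe.tOfArchType (archTypeOfRecord μω) ι) := by
  rw [mem_archPacketOfRecord_iff, archPacketOfRecord_πn_ofRecord]

/-! ## §3 (★) Every `(𝔤,K)`-token of a cotangent `P` has the archimedean class of record `clInfChoiceU [J⁺] P` -/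

section Frame

variable (L : Type) [Field L] [NumberField L] [IsCMField L] (ι : L →+* ℂ) (H : Matrix (Fin 3) (Fin 3) L) (T : GL (Fin 3) ℂ)
  (hT : (T : Matrix (Fin 3) (Fin 3) ℂ)ᴴ * H.map ι * (T : Matrix (Fin 3) (Fin 3) ℂ) = Literature.Geometry.ComplexHyperbolic.BallModel.J)
  (hdef : ∀ τ' : L →+* ℂ, InfinitePlace.mk τ' ≠ InfinitePlace.mk ι → (H.map τ').PosDef)
  (h2 : 2 ≤ Module.finrank ℚ ↥(maximalRealSubfield L))
  (μ : Measure (adelicGroupData (↥(maximalRealSubfield L)) L (IsCMField.complexConj L) 3 H).automorphicQuotient)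
  [(adelicGroupData (↥(maximalRealSubfield L)) L (IsCMField.complexConj L) 3 H).IsAutomorphicMeasure μ]
  (P : DiscreteAutomorphicRep (adelicGroupData (↥(maximalRealSubfield L)) L (IsCMField.complexConj L) 3 H) μ)
  (hP : P.IsHolCotangentAt (cmArchSection L ι H T hT) (cmCompactFactor L ι H T hT) ∨
    P.IsAntiholCotangentAt (cmArchSection L ι H T hT) (cmCompactFactor L ι H T hT))

include hdef h2 hP

/-- **EVERY `(𝔤,K)`-token of a cotangent `P` has the archimedean class of record**: `GKIrrClass.ofModule M σK σ𝔤 = clInfChoiceU [J⁺] P`.  F1a (archimedean isotypy) for a cotangent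
`P` is ★ (`archIsotypy_cm_of_hol_half` ∘ `archIsotypy_of_isHolCotangentAt`), a coh-unitary token is ★ (`exists_cohUnitaryToken_of_isCot_cpt`), and two tokens of one `P` are
`(𝔤,K)`-equivalent (★ `clInfChoiceU_eq_ofModule`).  In print: every token target of an automorphic `π′` is the Harish-Chandra module of its unitary component `π′_ι`.
[cite: Rogawski1990, §14.5 p. 237; Prop. 15.2.1 (b) p. 249] [cite: FlathCorvallis1979, Thm. 3] [cite: BorelWallach2000, VI Thm. 4.11; VII 2.10] -/
theorem tokenClass_eq_clInfChoiceU_of_isCot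
    {M : Type} [AddCommGroup M] [Module ℂ M] {σK : Representation ℂ (uFormGroup (Fin 2) (Fin 1)).maximalCompact M}
    {σ𝔤 : (uFormGroup (Fin 2) (Fin 1)).lie →ₗ⁅ℝ⁆ Module.End ℂ M} (hM : IsGKModule (uFormGroup (Fin 2) (Fin 1)) σK σ𝔤) (hirr : IsIrreducibleGK σK σ𝔤)
    (htok : HasToken L H ι T hT μ P M σK σ𝔤) :
    GKIrrClass.ofModule M σK σ𝔤 hM hirr = clInfChoiceU L H ι T hT μ (archDegOneClass 1 (Or.inl rfl)) P := by
  have hF1a : P.ArchIsotypy (uFormGroup (Fin 2) (Fin 1)) (cmArchSectionUForm L ι H T hT) :=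
    archIsotypy_cm_of_hol_half L ι H T hT μ (fun P' hP' => F0P3StubF1aHolHalf.archIsotypy_of_isHolCotangentAt ι T hT hdef h2 μ P' hP') P hP
  exact (clInfChoiceU_eq_ofModule L H ι T hT μ (archDegOneClass 1 (Or.inl rfl)) P hF1a
    (exists_cohUnitaryToken_of_isCot_cpt L H ι T hT μ hdef h2 P hP) hM hirr htok).symm

end Frame

/-! ## §4 The junction: «(S-G)∞» BY TYPE ⟹ `ArchMemberIota` of record ⟹ Σ∞-ι ⟹ Ξ∞ modulo Σ∞-cpt (PROVED; logic + ★; no socket applied) -/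

/-- **JQ-S7-7c — THE S7-R20 TARGET FROM «(S-G)∞» BY TYPE**: `ArchMemberIota` over the carriers of record (XiA :126 at ★ `jInfOfRecord` ∕ `dsInfOfRecord`).  For the token
`(M, σK, σ𝔤)` of `P`: §3 identifies `[M]` with `clInfChoiceU [J⁺] P`, «(S-G)∞» puts that class in the packet of record, §2 reads membership as the disjunction.
[cite: Rogawski1990, §14.6 Thm. 14.6.4 p. 243 and proof p. 244; §12.3 Prop. 12.3.3 p. 178] [cite: FlathCorvallis1979, Thm. 3] -/
theorem archMemberIota_of_sgInf (h : SGInfLetter) :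
    ArchMemberIota K2E1bCarriersOfRecord.jInfOfRecord K2E1bCarriersOfRecord.dsInfOfRecord := by
  intro L _ _ _ ι H T hT hdef h2 μ _ μω hμu hμω P hP M _ _ σK σ𝔤 hM hirr htok ξ hmem
  have hcls := tokenClass_eq_clInfChoiceU_of_isCot L ι H T hT hdef h2 μ P hP hM hirr htok
  have hres := h L ι H T hT hdef h2 μ μω hμu hμω P hP ξ hmem
  rw [← hcls] at hres
  exact (mem_archPacketOfRecord_ofRecord_iff ι μω ξ _).1 hres

/-- **Σ∞-ι FROM «(S-G)∞» BY TYPE** — the type of S2's socket `R90.S2.stub_R90_S2_archPacketIota` (XiA :169), through the ★-grade door `archPacketIotaLetter_of_ofRecord` (XiA :242: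
carriers of record + ★ K6 clauses `archClauses_tableOfRecord`). [cite: Rogawski1990, §14.6 Thm. 14.6.4 p. 243; §12.3 Prop. 12.3.3 p. 178; Prop. 15.2.1 p. 249] -/
theorem archPacketIota_of_sgInf (h : SGInfLetter) : ArchPacketIotaLetter :=
  archPacketIotaLetter_of_ofRecord (archMemberIota_of_sgInf h)

/-- **THE ORGAN Ξ∞ `S2QpsiLetter` (LH1 leaf ED. 5 :328) FROM «(S-G)∞» BY TYPE AND Σ∞-cpt BY TYPE** (XiA's head `s2Qpsi_of_sigmas` :203 fed with `archPacketIota_of_sgInf`).  The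
paid-modulo head `s2Qpsi_paid₂ := s2Qpsi_of_sgInf ‹S9's export› R90.S2.stub_R90_S2_archPacketCompact` is the R90 INDEX's line, not this file's (no socket is applied here).
[cite: Rogawski1990, §14.6 Thm. 14.6.4 p. 243; §12.3 p. 178] [cite: Marshall2014, §3.3 ¶3; §4.1] -/
theorem s2Qpsi_of_sgInf (h : SGInfLetter) (hcpt : S2PinCompactLetter) : S2QpsiLetter :=
  s2Qpsi_of_sigmas (archPacketIota_of_sgInf h) hcpt

/-! ## §5 (★, EDITION 2) «(S-G)∞» and its tuple-currency twin are EQUIVALENT — the S7∕S2 layer of JQ-S7-7c carries no residue; doors from the twin -/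

/-- **E1 ⟺ «(S-G)∞_tup»** (one line each way over the ★ (m1) brick: the letter-free `Set` transport `clInfChoiceU_mem_iff_tupleOf_fst_mem` at `S := (archPacketOfRecord …).members`, with `isKcSpherical_of_isCot` supplying the witness).  Hence S9's export may inhabit EITHER letter.
[cite: Rogawski1990, §14.6 Thm. 14.6.4 p. 243; §14.5 p. 237; Prop. 15.2.1 (b) p. 249] [cite: FlathCorvallis1979, Thm. 3] -/
theorem sgInf_iff_tuple : SGInfLetter ↔ SGInfTupleLetter := by
  constructor
  · intro h L _ _ _ ι H T hT hdef h2 μ _ μω hμu hμω P hP ξ hmem hsph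
    exact (clInfChoiceU_mem_iff_tupleOf_fst_mem L ι H T hT hdef h2 μ P hP hsph _).1 (h L ι H T hT hdef h2 μ μω hμu hμω P hP ξ hmem)
  · intro h L _ _ _ ι H T hT hdef h2 μ _ μω hμu hμω P hP ξ hmem
    exact (clInfChoiceU_mem_iff_tupleOf_fst_mem L ι H T hT hdef h2 μ P hP (isKcSpherical_of_isCot L ι H T hT μ P hP) _).2
      (h L ι H T hT hdef h2 μ μω hμu hμω P hP ξ hmem _)

/-- **JQ-S7-7c FROM THE TUPLE TWIN BY TYPE**: `ArchMemberIota` over the carriers of record. [cite: Rogawski1990, §14.6 Thm. 14.6.4 p. 243 and proof p. 244; §12.3 Prop. 12.3.3 p. 178] -/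
theorem archMemberIota_of_sgInfTuple (h : SGInfTupleLetter) :
    ArchMemberIota K2E1bCarriersOfRecord.jInfOfRecord K2E1bCarriersOfRecord.dsInfOfRecord :=
  archMemberIota_of_sgInf (sgInf_iff_tuple.2 h)

/-- **Σ∞-ι FROM THE TUPLE TWIN BY TYPE** (the type of S2's socket `R90.S2.stub_R90_S2_archPacketIota`, XiA :169). [cite: Rogawski1990, §14.6 Thm. 14.6.4 p. 243; §12.3 Prop. 12.3.3 p. 178] -/
theorem archPacketIota_of_sgInfTuple (h : SGInfTupleLetter) : ArchPacketIotaLetter :=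
  archPacketIota_of_sgInf (sgInf_iff_tuple.2 h)

/-- **THE ORGAN Ξ∞ `S2QpsiLetter` FROM THE TUPLE TWIN BY TYPE AND Σ∞-cpt BY TYPE** (no socket applied; the paid-modulo head is the R90 INDEX's line).
[cite: Rogawski1990, §14.6 Thm. 14.6.4 p. 243; §12.3 p. 178] [cite: Marshall2014, §3.3 ¶3; §4.1] -/
theorem s2Qpsi_of_sgInfTuple (h : SGInfTupleLetter) (hcpt : S2PinCompactLetter) : S2QpsiLetter :=
  s2Qpsi_of_sgInf (sgInf_iff_tuple.2 h) hcpt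

end Summit.HodgeConjecture.HodgeConjecture.R90.S7

end
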